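import Summits.BirchSwinnertonDyer.BirchSwinnertonDyer.Theorems.PrintCf2SplitBadTwoRestrictedSelmerConjTransportFrame
import Literature.NumberTheory.EllipticCurves.ComplexMultiplicationTwistIsogenyProofs
import HarnessLib

/-!
# Crux `PrintCf2.SplitBadTwoRankOneOfFacts` (stmt-BirchSwinnertonDyer-20368), road α v10.3 — brick (CT-𝔖), file 4:
# **`hTr` OF THE LEAD'S CUT 10 (`restrictedControl_two_of_locSurj_bv`, p672187) IS A THEOREM — VERBATIM**

Cell `bsd-print-cf2`, width seat `bsd-line-cf2-p1-w2` g10 (prover-bsd-line-cf2-p1-w2-g10-0); `--supports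
stmt-BirchSwinnertonDyer-20368` (helper, Theses-free). HONEST FRAMING: nothing here closes a crux or a stub; BSD is not
proved by any of this; no summit statement is proved by this seat. THEOREMS ONLY (no definition, no named fact, no `sorry`).

The LEAD's tenth cut of S3c `stub_restrictedControl_two` (`RestrictedSelmerPair.restrictedControl_two_of_locSurj_bv`, LEAD g12,
executing -w5 g3's proposal `rTop'_of_locSurj_of_finite` / `rSurj''_of_locSurj_of_finite`) displays, next to the two named facts
`hPT`, `hcd`, the hypothesis **`hTr` = (CT-𝔖)**: on every frame `(d, W, C, K, v, v̄, π, r)` of the stub,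
`Finite 𝔖_{v̄}(K, W*) → Finite 𝔖_v(K, W*′)` (`W* = E[𝔮_r^∞]`, `W*′ = (W.baseChange K).endEigenPrimaryTorsion 2 π (1 − r)`).
`conjTransport_holds` below has EXACTLY that type (binder order `d hd0 hsq hd4 W [IsElliptic] C hC K [Field] [NumberField] hK v vbar
hv hvbar hne π hrel r hr hfin`, -w5 g3 21:56:01Z) and is file 3's `ConjTransport.finite_restrictedSelmerBase_conj_of_finite` with the
idle binders (`d`, `C`, `r² = r − 2`) dropped: pass it BY NAME as `hTr`. Also recorded: the `Nat.card` form in the same currency.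

References: A. Agboola, Compositio 143 (2007) §3, §6 [Agboola2007]; J. Neukirch, A. Schmidt, K. Wingberg (2008) I §5
[NeukirchSchmidtWingberg2008].
-/

noncomputable section

open scoped Classical

set_option linter.dupNamespace false
set_option autoImplicit false

namespace Summit.BirchSwinnertonDyer.BirchSwinnertonDyer.Theorems.PrintCf2.ConjTransport

open WeierstrassCurve Literature.NumberTheory.EllipticCurves Literature.NumberTheory.EllipticCurves.Agboola2007
open Field NumberField IsDedekindDomain

/-- **(CT-𝔖) = `hTr` of `restrictedControl_two_of_locSurj_bv` (cut 10), VERBATIM.** On every frame of S3c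
`stub_restrictedControl_two`: `Finite 𝔖_{v̄}(K, E[𝔮_r^∞]) → Finite 𝔖_v(K, E[𝔮_{1−r}^∞])` — the conjugate-summand finiteness
transport along the anti-commuting lift of complex conjugation (file 3 `finite_restrictedSelmerBase_conj_of_finite`; files 1–2 for the
cohomological and Galois-theoretic halves). [cite: Agboola2007, §6 Prop. 6.10–6.11 (finiteness of the restricted Selmer group over K)]
[cite: NeukirchSchmidtWingberg2008, I §5 (conjugation on cohomology)] -/
theorem conjTransport_holds :
    ∀ (d : ℤ), d ≠ 0 → Squarefree d → d % 4 ≠ 1 →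
      ∀ (W : WeierstrassCurve ℚ) [W.IsElliptic] (C : VariableChange ℚ), C • W = cm7.quadraticTwist (d : ℚ) →
      ∀ (K : Type) [Field K] [NumberField K], IsImaginaryQuadratic K →
      ∀ (v vbar : HeightOneSpectrum (𝓞 K)),
        ((2 : ℕ) : 𝓞 K) ∈ v.asIdeal → ((2 : ℕ) : 𝓞 K) ∈ vbar.asIdeal → vbar ≠ v →
      ∀ (π : (W.baseChange K).endRing), (π : AddMonoid.End (W.baseChange K).geomPoints) * π = π - 2 →
      ∀ (r : ℤ_[2]), r * r = r - 2 →
      Finite (restrictedSelmerBase ↥((W.baseChange K).endEigenPrimaryTorsion 2 π r) 2 vbar) →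
      Finite (restrictedSelmerBase ↥((W.baseChange K).endEigenPrimaryTorsion 2 π (1 - r)) 2 v) :=
  fun _ _ _ _ W _ _ _ K _ _ hK v vbar hv hvbar hne π hrel r _ hfin ↦
    finite_restrictedSelmerBase_conj_of_finite W K hK v vbar hv hvbar hne π hrel r hfin

/-- The same transport in the `Nat.card` currency, on every frame: `Nat.card 𝔖_{v̄}(K, E[𝔮_r^∞]) = Nat.card 𝔖_v(K, E[𝔮_{1−r}^∞])`
(so every index / valuation statement about the one is a statement about the other).
[cite: Agboola2007, §6 (restricted Selmer groups over K)] -/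
theorem conjTransport_natCard_holds :
    ∀ (d : ℤ), d ≠ 0 → Squarefree d → d % 4 ≠ 1 →
      ∀ (W : WeierstrassCurve ℚ) [W.IsElliptic] (C : VariableChange ℚ), C • W = cm7.quadraticTwist (d : ℚ) →
      ∀ (K : Type) [Field K] [NumberField K], IsImaginaryQuadratic K →
      ∀ (v vbar : HeightOneSpectrum (𝓞 K)),
        ((2 : ℕ) : 𝓞 K) ∈ v.asIdeal → ((2 : ℕ) : 𝓞 K) ∈ vbar.asIdeal → vbar ≠ v →
      ∀ (π : (W.baseChange K).endRing), (π : AddMonoid.End (W.baseChange K).geomPoints) * π = π - 2 →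
      ∀ (r : ℤ_[2]), r * r = r - 2 →
      Nat.card ↥(restrictedSelmerBase ↥((W.baseChange K).endEigenPrimaryTorsion 2 π r) 2 vbar) =
        Nat.card ↥(restrictedSelmerBase ↥((W.baseChange K).endEigenPrimaryTorsion 2 π (1 - r)) 2 v) :=
  fun _ _ _ _ W _ _ _ K _ _ hK _ _ hv hvbar hne π hrel r _ ↦
    natCard_restrictedSelmerBase_conj W K hK hv hvbar hne π hrel r

end Summit.BirchSwinnertonDyer.BirchSwinnertonDyer.Theorems.PrintCf2.ConjTransport

end
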